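import Mathlib
import Summits.HodgeConjecture.HodgeConjecture.Theorems.WeilClassTestFormatFiveThreeCrossPlusOneReduced
import Summits.HodgeConjecture.HodgeConjecture.Theorems.WeilClassTestFormatFiveThreeCrossPlusOneAggregates
import Summits.HodgeConjecture.HodgeConjecture.Theorems.WeilClassTestFormatFiveThreeCrossPlusOneGauge

/-!
# Conjecture N (hodge-weil ladder, GAPS G51b), format (5,3): CONJECTURE N ON CROSS + ONE FREE ROOT, WITH (P1)

Prover 2, generation 22 (note `run/shared/lean/b2b/hodge-weil/b2b-hweil-pv2-g22/CROSSPLUS1-G22.md`). Setting of `CONJECTURE-N.md` §1, format (5,3),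
centred real coordinates, `G = Q₂ + Q₄`. Generation 21 (`WeilClassTestFormatFiveThreeCrossLemma.conjectureN_53_cross`) proved `G ≥ 0` on every CROSS
(all eight roots on the two null lines through a base point) with `P2 = P4 = 0` and WITHOUT (P1). THIS FILE proves `G ≥ 0` on the next stratum:
seven roots on the cross and one E-root FREE, for pure configurations (`P1 = P2 = P4 = 0`) — the first case of Conjecture N on the mixed patterns
in which (P1) enters. Chain: `G_gauge_cross_plus_one` (value of `G`), `S/P2/P4/K_on_cross_plus_one` (aggregates), Cauchy–Schwarz on each null
line (`cauchy_schwarz_H/V`: `(D⁺−x₁²)² ≤ (X−x₁)(C₃⁺−x₁³)` for the corner measure `t·μ`), `aggregate_cross_plus_one` ⟸ `reduced_cross_plus_one`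
(endpoint principle: on the purity line the three quantities are concave quadratics in `D⁺`) ⟸ `pieceP` (on `{h_p = 0}` everything factors into
linear factors). **`conjectureN_53_cross_plus_one`** is the configuration-level statement, hypotheses exactly as in `conjectureN_53_cross` with
`x₁·y₁ = 0` and `S ≥ 0` replaced by `P1 = 0`. Pure real algebra; nothing here is a case of HC, a rung or a door edge; no statement of Markman's
papers is used; COUNT of record unchanged. New cell result ⇒ Summits/.
-/

set_option linter.dupNamespace false
set_option maxRecDepth 16384

namespace Summit.HodgeConjecture.HodgeConjecture.WeilClassTestFormatFiveThreeCrossPlusOne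

/-- AGGREGATE FORM. For reals `X, M, D⁺, D⁻, C₃⁺, C₃⁻, x₁, y₁, us` with `2us = M − X`, `x₁, y₁ ≥ 0`, `X − x₁ ≥ 0`, `M − y₁ ≥ 0`, the purity relations
`P2 = P4 = 0`, `K = P4 − P1 = 0` in aggregate form and the two Cauchy–Schwarz inequalities `(D⁺ − x₁²)² ≤ (X − x₁)(C₃⁺ − x₁³)`,
`(D⁻ − y₁²)² ≤ (M − y₁)(C₃⁻ − y₁³)`, the gauge value `Mo² + (S/2)T² − S² − 2S·us² − 4x₁y₁(3(u₁² − S/2) + S)` (`Mo = us·T + D⁺ − D⁻`, `T = X + M`,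
`S = D⁺ + D⁻ − (X−M)²/2 − 2x₁y₁`, `u₁ = us + x₁ − y₁`) is `≥ 0` — by `…CrossPlusOneReduced.reduced_cross_plus_one` in the variables
`X1 = X − x₁, M1 = M − y₁, D1 = D⁺ − x₁², E1 = D⁻ − y₁²` (the two purity sums express `C₃±` through the other aggregates). -/
theorem aggregate_cross_plus_one (X M Dp Dm Cp Cm x₁ y₁ us : ℝ) (hus : 2 * us = M - X) (hx : 0 ≤ x₁) (hy : 0 ≤ y₁)
    (hX1 : 0 ≤ X - x₁) (hM1 : 0 ≤ M - y₁)
    (hP2 : Cm + Cp - 3*Dm*M/2 + Dm*X/2 + Dp*M/2 - 3*Dp*X/2 + M^3/2 - M^2*X/2 - M*X^2/2 + M*x₁*y₁ + X^3/2 + X*x₁*y₁ - x₁^2*y₁ - x₁*y₁^2 = 0)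
    (hP4 : -Cm + Cp + 3*Dm*M/2 - 3*Dm*X/2 + 3*Dp*M/2 - 3*Dp*X/2 - M^3/2 + 3*M^2*X/2 - 3*M*X^2/2 - 3*M*x₁*y₁ + X^3/2 + 3*X*x₁*y₁ - 3*x₁^2*y₁ + 3*x₁*y₁^2 = 0)
    (hK : -2*Dm*X + 2*Dp*M + 2*M^2*X - 2*M*X^2 - 4*M*x₁*y₁ + 4*X*x₁*y₁ - 4*x₁^2*y₁ + 4*x₁*y₁^2 = 0)
    (hCSp : (Dp - x₁ ^ 2) ^ 2 ≤ (X - x₁) * (Cp - x₁ ^ 3)) (hCSm : (Dm - y₁ ^ 2) ^ 2 ≤ (M - y₁) * (Cm - y₁ ^ 3)) :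
    0 ≤ (us * (X + M) + (Dp - Dm)) ^ 2 + ((Dm + Dp - M^2/2 + M*X - X^2/2 - 2*x₁*y₁) / 2) * (X + M) ^ 2 - (Dm + Dp - M^2/2 + M*X - X^2/2 - 2*x₁*y₁) ^ 2 - 2 * (Dm + Dp - M^2/2 + M*X - X^2/2 - 2*x₁*y₁) * us ^ 2
        - 4 * (x₁ * y₁) * (3 * ((us + x₁ - y₁) ^ 2 - (Dm + Dp - M^2/2 + M*X - X^2/2 - 2*x₁*y₁) / 2) + (Dm + Dp - M^2/2 + M*X - X^2/2 - 2*x₁*y₁)) := by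
  have hus' : us = (M - X) / 2 := by linarith
  subst hus'
  have hKr : 2*(Dp - x₁^2)*(M - y₁) + 2*(Dp - x₁^2)*y₁ - 2*(Dm - y₁^2)*(X - x₁) - 2*(Dm - y₁^2)*x₁ + 2*(M - y₁)^2*(X - x₁) + 2*(M - y₁)^2*x₁ - 2*(M - y₁)*(X - x₁)^2 - 4*(M - y₁)*(X - x₁)*x₁ + 4*(M - y₁)*(X - x₁)*y₁ - 2*(X - x₁)^2*y₁ = 0 := by linear_combination hK
  have hpr : 0 ≤ (X - x₁) * ((-2*(Dp - x₁^2)*(M - y₁) + 3*(Dp - x₁^2)*(X - x₁) + 3*(Dp - x₁^2)*x₁ - 2*(Dp - x₁^2)*y₁ + (Dm - y₁^2)*(X - x₁) + (Dm - y₁^2)*x₁ - (M - y₁)^2*(X - x₁) - (M - y₁)^2*x₁ + 2*(M - y₁)*(X - x₁)^2 + 4*(M - y₁)*(X - x₁)*x₁ - 2*(M - y₁)*(X - x₁)*y₁ - (X - x₁)^3 - 3*(X - x₁)^2*x₁ + 2*(X - x₁)^2*y₁) / 2) - (Dp - x₁^2)^2 := by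
    have e : (X - x₁) * ((-2*(Dp - x₁^2)*(M - y₁) + 3*(Dp - x₁^2)*(X - x₁) + 3*(Dp - x₁^2)*x₁ - 2*(Dp - x₁^2)*y₁ + (Dm - y₁^2)*(X - x₁) + (Dm - y₁^2)*x₁ - (M - y₁)^2*(X - x₁) - (M - y₁)^2*x₁ + 2*(M - y₁)*(X - x₁)^2 + 4*(M - y₁)*(X - x₁)*x₁ - 2*(M - y₁)*(X - x₁)*y₁ - (X - x₁)^3 - 3*(X - x₁)^2*x₁ + 2*(X - x₁)^2*y₁) / 2) - (Dp - x₁^2)^2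
        = ((X - x₁) * (Cp - x₁ ^ 3) - (Dp - x₁ ^ 2) ^ 2) - (X - x₁) / 2 * (Cm + Cp - 3*Dm*M/2 + Dm*X/2 + Dp*M/2 - 3*Dp*X/2 + M^3/2 - M^2*X/2 - M*X^2/2 + M*x₁*y₁ + X^3/2 + X*x₁*y₁ - x₁^2*y₁ - x₁*y₁^2) - (X - x₁) / 2 * (-Cm + Cp + 3*Dm*M/2 - 3*Dm*X/2 + 3*Dp*M/2 - 3*Dp*X/2 - M^3/2 + 3*M^2*X/2 - 3*M*X^2/2 - 3*M*x₁*y₁ + X^3/2 + 3*X*x₁*y₁ - 3*x₁^2*y₁ + 3*x₁*y₁^2) := by ring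
    rw [e, hP2, hP4]; linarith
  have hmr : 0 ≤ (M - y₁) * (((Dp - x₁^2)*(M - y₁) + (Dp - x₁^2)*y₁ + 3*(Dm - y₁^2)*(M - y₁) - 2*(Dm - y₁^2)*(X - x₁) - 2*(Dm - y₁^2)*x₁ + 3*(Dm - y₁^2)*y₁ - (M - y₁)^3 + 2*(M - y₁)^2*(X - x₁) + 2*(M - y₁)^2*x₁ - 3*(M - y₁)^2*y₁ - (M - y₁)*(X - x₁)^2 - 2*(M - y₁)*(X - x₁)*x₁ + 4*(M - y₁)*(X - x₁)*y₁ - (X - x₁)^2*y₁) / 2) - (Dm - y₁^2)^2 := by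
    have e : (M - y₁) * (((Dp - x₁^2)*(M - y₁) + (Dp - x₁^2)*y₁ + 3*(Dm - y₁^2)*(M - y₁) - 2*(Dm - y₁^2)*(X - x₁) - 2*(Dm - y₁^2)*x₁ + 3*(Dm - y₁^2)*y₁ - (M - y₁)^3 + 2*(M - y₁)^2*(X - x₁) + 2*(M - y₁)^2*x₁ - 3*(M - y₁)^2*y₁ - (M - y₁)*(X - x₁)^2 - 2*(M - y₁)*(X - x₁)*x₁ + 4*(M - y₁)*(X - x₁)*y₁ - (X - x₁)^2*y₁) / 2) - (Dm - y₁^2)^2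
        = ((M - y₁) * (Cm - y₁ ^ 3) - (Dm - y₁ ^ 2) ^ 2) - (M - y₁) / 2 * (Cm + Cp - 3*Dm*M/2 + Dm*X/2 + Dp*M/2 - 3*Dp*X/2 + M^3/2 - M^2*X/2 - M*X^2/2 + M*x₁*y₁ + X^3/2 + X*x₁*y₁ - x₁^2*y₁ - x₁*y₁^2) + (M - y₁) / 2 * (-Cm + Cp + 3*Dm*M/2 - 3*Dm*X/2 + 3*Dp*M/2 - 3*Dp*X/2 - M^3/2 + 3*M^2*X/2 - 3*M*X^2/2 - 3*M*x₁*y₁ + X^3/2 + 3*X*x₁*y₁ - 3*x₁^2*y₁ + 3*x₁*y₁^2) := by ring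
    rw [e, hP2, hP4]; linarith
  have key := Summit.HodgeConjecture.HodgeConjecture.WeilClassTestFormatFiveThreeCrossPlusOneReduced.reduced_cross_plus_one
    (X - x₁) (M - y₁) x₁ y₁ (Dp - x₁^2) (Dm - y₁^2) hX1 hM1 hx hy hKr hpr hmr
  have e2 : (((M - X) / 2) * (X + M) + (Dp - Dm)) ^ 2 + ((Dm + Dp - M^2/2 + M*X - X^2/2 - 2*x₁*y₁) / 2) * (X + M) ^ 2 - (Dm + Dp - M^2/2 + M*X - X^2/2 - 2*x₁*y₁) ^ 2 - 2 * (Dm + Dp - M^2/2 + M*X - X^2/2 - 2*x₁*y₁) * ((M - X) / 2) ^ 2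
        - 4 * (x₁ * y₁) * (3 * ((((M - X) / 2) + x₁ - y₁) ^ 2 - (Dm + Dp - M^2/2 + M*X - X^2/2 - 2*x₁*y₁) / 2) + (Dm + Dp - M^2/2 + M*X - X^2/2 - 2*x₁*y₁))
      = -4*(Dp - x₁^2)*(Dm - y₁^2) + 2*(Dp - x₁^2)*(M - y₁)^2 + 4*(Dp - x₁^2)*(M - y₁)*y₁ + 6*(Dp - x₁^2)*x₁*y₁ - 2*(Dp - x₁^2)*y₁^2 + 2*(Dm - y₁^2)*(X - x₁)^2 + 4*(Dm - y₁^2)*(X - x₁)*x₁ - 2*(Dm - y₁^2)*x₁^2 + 6*(Dm - y₁^2)*x₁*y₁ + 2*(M - y₁)^2*x₁^2 - 6*(M - y₁)^2*x₁*y₁ + 8*(M - y₁)*(X - x₁)*x₁*y₁ - 6*(X - x₁)^2*x₁*y₁ + 2*(X - x₁)^2*y₁^2 := by ring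
  rw [e2]; exact key

/-- Cauchy–Schwarz for the H-axis corner measure of the roots other than E₁ (`ν = Σ_{e≥2} x_e δ_{x_e} + Σ_g p_g δ_{−p_g} ≥ 0`): `ν(t)² ≤ ν(1)·ν(t²)`, i.e. `(D⁺ − x₁²)² ≤ (X − x₁)(C₃⁺ − x₁³)`. -/
theorem cauchy_schwarz_H (x₁ x₂ x₃ x₄ x₅ p₁ p₂ p₃ : ℝ) (hx₂ : 0 ≤ x₂) (hx₃ : 0 ≤ x₃) (hx₄ : 0 ≤ x₄) (hx₅ : 0 ≤ x₅) (hp₁ : 0 ≤ p₁) (hp₂ : 0 ≤ p₂) (hp₃ : 0 ≤ p₃) :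
    (((x₁ ^ 2 + x₂ ^ 2 + x₃ ^ 2 + x₄ ^ 2 + x₅ ^ 2) - (p₁ ^ 2 + p₂ ^ 2 + p₃ ^ 2)) - x₁ ^ 2) ^ 2 ≤ ((x₁ + x₂ + x₃ + x₄ + x₅ + p₁ + p₂ + p₃) - x₁) * (((x₁ ^ 3 + x₂ ^ 3 + x₃ ^ 3 + x₄ ^ 3 + x₅ ^ 3) + (p₁ ^ 3 + p₂ ^ 3 + p₃ ^ 3)) - x₁ ^ 3) := by
  have e : ((x₁ + x₂ + x₃ + x₄ + x₅ + p₁ + p₂ + p₃) - x₁) * (((x₁ ^ 3 + x₂ ^ 3 + x₃ ^ 3 + x₄ ^ 3 + x₅ ^ 3) + (p₁ ^ 3 + p₂ ^ 3 + p₃ ^ 3)) - x₁ ^ 3) - (((x₁ ^ 2 + x₂ ^ 2 + x₃ ^ 2 + x₄ ^ 2 + x₅ ^ 2) - (p₁ ^ 2 + p₂ ^ 2 + p₃ ^ 2)) - x₁ ^ 2) ^ 2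
      = x₂ * x₃ * (x₂ - x₃) ^ 2 + x₂ * x₄ * (x₂ - x₄) ^ 2 + x₂ * x₅ * (x₂ - x₅) ^ 2 + x₂ * p₁ * (x₂ - (-p₁)) ^ 2 + x₂ * p₂ * (x₂ - (-p₂)) ^ 2 + x₂ * p₃ * (x₂ - (-p₃)) ^ 2 + x₃ * x₄ * (x₃ - x₄) ^ 2 + x₃ * x₅ * (x₃ - x₅) ^ 2 + x₃ * p₁ * (x₃ - (-p₁)) ^ 2 + x₃ * p₂ * (x₃ - (-p₂)) ^ 2 + x₃ * p₃ * (x₃ - (-p₃)) ^ 2 + x₄ * x₅ * (x₄ - x₅) ^ 2 + x₄ * p₁ * (x₄ - (-p₁)) ^ 2 + x₄ * p₂ * (x₄ - (-p₂)) ^ 2 + x₄ * p₃ * (x₄ - (-p₃)) ^ 2 + x₅ * p₁ * (x₅ - (-p₁)) ^ 2 + x₅ * p₂ * (x₅ - (-p₂)) ^ 2 + x₅ * p₃ * (x₅ - (-p₃)) ^ 2 + p₁ * p₂ * ((-p₁) - (-p₂)) ^ 2 + p₁ * p₃ * ((-p₁) - (-p₃)) ^ 2 + p₂ * p₃ * ((-p₂)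 - (-p₃)) ^ 2 := by ring
  have h : 0 ≤ x₂ * x₃ * (x₂ - x₃) ^ 2 + x₂ * x₄ * (x₂ - x₄) ^ 2 + x₂ * x₅ * (x₂ - x₅) ^ 2 + x₂ * p₁ * (x₂ - (-p₁)) ^ 2 + x₂ * p₂ * (x₂ - (-p₂)) ^ 2 + x₂ * p₃ * (x₂ - (-p₃)) ^ 2 + x₃ * x₄ * (x₃ - x₄) ^ 2 + x₃ * x₅ * (x₃ - x₅) ^ 2 + x₃ * p₁ * (x₃ - (-p₁)) ^ 2 + x₃ * p₂ * (x₃ - (-p₂)) ^ 2 + x₃ * p₃ * (x₃ - (-p₃)) ^ 2 + x₄ * x₅ * (x₄ - x₅) ^ 2 + x₄ * p₁ * (x₄ - (-p₁)) ^ 2 + x₄ * p₂ * (x₄ - (-p₂)) ^ 2 + x₄ * p₃ * (x₄ - (-p₃)) ^ 2 + x₅ * p₁ * (x₅ - (-p₁)) ^ 2 + x₅ * p₂ * (x₅ - (-p₂)) ^ 2 + x₅ * p₃ * (x₅ - (-p₃)) ^ 2 + p₁ * p₂ * ((-p₁) - (-p₂)) ^ 2 + p₁ * p₃ * ((-p₁)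 - (-p₃)) ^ 2 + p₂ * p₃ * ((-p₂) - (-p₃)) ^ 2 := by positivity
  linarith

/-- Cauchy–Schwarz for the V-axis corner measure of the roots other than E₁: `(D⁻ − y₁²)² ≤ (M − y₁)(C₃⁻ − y₁³)`. -/
theorem cauchy_schwarz_V (y₁ y₂ y₃ y₄ y₅ q₁ q₂ q₃ : ℝ) (hy₂ : 0 ≤ y₂) (hy₃ : 0 ≤ y₃) (hy₄ : 0 ≤ y₄) (hy₅ : 0 ≤ y₅) (hq₁ : 0 ≤ q₁) (hq₂ : 0 ≤ q₂) (hq₃ : 0 ≤ q₃) :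
    (((y₁ ^ 2 + y₂ ^ 2 + y₃ ^ 2 + y₄ ^ 2 + y₅ ^ 2) - (q₁ ^ 2 + q₂ ^ 2 + q₃ ^ 2)) - y₁ ^ 2) ^ 2 ≤ ((y₁ + y₂ + y₃ + y₄ + y₅ + q₁ + q₂ + q₃) - y₁) * (((y₁ ^ 3 + y₂ ^ 3 + y₃ ^ 3 + y₄ ^ 3 + y₅ ^ 3) + (q₁ ^ 3 + q₂ ^ 3 + q₃ ^ 3)) - y₁ ^ 3) := by
  have e : ((y₁ + y₂ + y₃ + y₄ + y₅ + q₁ + q₂ + q₃) - y₁) * (((y₁ ^ 3 + y₂ ^ 3 + y₃ ^ 3 + y₄ ^ 3 + y₅ ^ 3) + (q₁ ^ 3 + q₂ ^ 3 + q₃ ^ 3)) - y₁ ^ 3) - (((y₁ ^ 2 + y₂ ^ 2 + y₃ ^ 2 + y₄ ^ 2 + y₅ ^ 2) - (q₁ ^ 2 + q₂ ^ 2 + q₃ ^ 2)) - y₁ ^ 2) ^ 2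
      = y₂ * y₃ * (y₂ - y₃) ^ 2 + y₂ * y₄ * (y₂ - y₄) ^ 2 + y₂ * y₅ * (y₂ - y₅) ^ 2 + y₂ * q₁ * (y₂ - (-q₁)) ^ 2 + y₂ * q₂ * (y₂ - (-q₂)) ^ 2 + y₂ * q₃ * (y₂ - (-q₃)) ^ 2 + y₃ * y₄ * (y₃ - y₄) ^ 2 + y₃ * y₅ * (y₃ - y₅) ^ 2 + y₃ * q₁ * (y₃ - (-q₁)) ^ 2 + y₃ * q₂ * (y₃ - (-q₂)) ^ 2 + y₃ * q₃ * (y₃ - (-q₃)) ^ 2 + y₄ * y₅ * (y₄ - y₅) ^ 2 + y₄ * q₁ * (y₄ - (-q₁)) ^ 2 + y₄ * q₂ * (y₄ - (-q₂)) ^ 2 + y₄ * q₃ * (y₄ - (-q₃)) ^ 2 + y₅ * q₁ * (y₅ - (-q₁)) ^ 2 + y₅ * q₂ * (y₅ - (-q₂)) ^ 2 + y₅ * q₃ * (y₅ - (-q₃)) ^ 2 + q₁ * q₂ * ((-q₁) - (-q₂)) ^ 2 + q₁ * q₃ * ((-q₁) - (-q₃)) ^ 2 + q₂ * q₃ * ((-q₂)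 - (-q₃)) ^ 2 := by ring
  have h : 0 ≤ y₂ * y₃ * (y₂ - y₃) ^ 2 + y₂ * y₄ * (y₂ - y₄) ^ 2 + y₂ * y₅ * (y₂ - y₅) ^ 2 + y₂ * q₁ * (y₂ - (-q₁)) ^ 2 + y₂ * q₂ * (y₂ - (-q₂)) ^ 2 + y₂ * q₃ * (y₂ - (-q₃)) ^ 2 + y₃ * y₄ * (y₃ - y₄) ^ 2 + y₃ * y₅ * (y₃ - y₅) ^ 2 + y₃ * q₁ * (y₃ - (-q₁)) ^ 2 + y₃ * q₂ * (y₃ - (-q₂)) ^ 2 + y₃ * q₃ * (y₃ - (-q₃)) ^ 2 + y₄ * y₅ * (y₄ - y₅) ^ 2 + y₄ * q₁ * (y₄ - (-q₁)) ^ 2 + y₄ * q₂ * (y₄ - (-q₂)) ^ 2 + y₄ * q₃ * (y₄ - (-q₃)) ^ 2 + y₅ * q₁ * (y₅ - (-q₁)) ^ 2 + y₅ * q₂ * (y₅ - (-q₂)) ^ 2 + y₅ * q₃ * (y₅ - (-q₃)) ^ 2 + q₁ * q₂ * ((-q₁) - (-q₂)) ^ 2 + q₁ * q₃ * ((-q₁)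 - (-q₃)) ^ 2 + q₂ * q₃ * ((-q₂) - (-q₃)) ^ 2 := by positivity
  linarith

/-- `Mo = Σ_k ch_k·H_k` in corner coordinates: `Mo = us·(X + M) + (D⁺ − D⁻)`. -/
theorem Mo_corner (x₁ x₂ x₃ x₄ x₅ y₁ y₂ y₃ y₄ y₅ p₁ p₂ p₃ q₁ q₂ q₃ us As : ℝ) :
    ((us + x₁ - y₁) * (As + x₁ + y₁ - As) + (us + x₂ - y₂) * (As + x₂ + y₂ - As) + (us + x₃ - y₃) * (As + x₃ + y₃ - As) + (us + x₄ - y₄) * (As + x₄ + y₄ - As) + (us + x₅ - y₅) * (As + x₅ + y₅ - As) + (us + q₁ - p₁) * (As - (As - p₁ - q₁)) + (us + q₂ - p₂) * (As - (As - p₂ - q₂)) + (us + q₃ - p₃) * (As - (As - p₃ - q₃))) = us * ((x₁ + x₂ + x₃ + x₄ + x₅ + p₁ + p₂ + p₃) + (y₁ + y₂ + y₃ + y₄ + y₅ + q₁ + q₂ + q₃)) + (((x₁ ^ 2 + x₂ ^ 2 + x₃ ^ 2 + x₄ ^ 2 + x₅ ^ 2) - (p₁ ^ 2 + p₂ ^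 2 + p₃ ^ 2)) - ((y₁ ^ 2 + y₂ ^ 2 + y₃ ^ 2 + y₄ ^ 2 + y₅ ^ 2) - (q₁ ^ 2 + q₂ ^ 2 + q₃ ^ 2))) := by ring

/-- `T = Σ_k H_k = X + M` in corner coordinates. -/
theorem T_corner (x₁ x₂ x₃ x₄ x₅ y₁ y₂ y₃ y₄ y₅ p₁ p₂ p₃ q₁ q₂ q₃ As : ℝ) :
    ((As + x₁ + y₁ - As) + (As + x₂ + y₂ - As) + (As + x₃ + y₃ - As) + (As + x₄ + y₄ - As) + (As + x₅ + y₅ - As) + (As - (As - p₁ - q₁)) + (As - (As - p₂ - q₂)) + (As - (As - p₃ - q₃))) = (x₁ + x₂ + x₃ + x₄ + x₅ + p₁ + p₂ + p₃) + (y₁ + y₂ + y₃ + y₄ + y₅ + q₁ + q₂ + q₃) := by ring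

set_option maxHeartbeats 4000000 in
/-- **CONJECTURE N ON 'CROSS + ONE FREE ROOT' CONFIGURATIONS (format (5,3)), WITH (P1).** A centred format-(5,3) configuration in corner
coordinates about a base point `(As, us)` — E-roots `(As + x_e + y_e, us + x_e − y_e)`, F-roots `(As − p_g − q_g, us + q_g − p_g)`,
`x, y, p, q ≥ 0` (automatically pairwise ample) — in which the roots `E₂, …, E₅, F₁, F₂, F₃` lie on the two null lines through the base point
(`x_e·y_e = 0`, `p_g·q_g = 0`) while `E₁` is ARBITRARY, and which is pure (`P1 = P2 = P4 = 0`), satisfies `G = Q₂ + Q₄ ≥ 0`.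
This is generation 21's cross lemma one stratum up: the first case of Conjecture N on the mixed patterns in which the purity relation (P1) is
used (it is needed: without it the statement fails off the cross). PROOF: `…CrossPlusOneGauge.G_gauge_cross_plus_one` evaluates `G`;
`…CrossPlusOneAggregates` turns `S, P2, P4, P4 − P1` into aggregate form; Cauchy–Schwarz on each null line (`cauchy_schwarz_H/V`); then
`aggregate_cross_plus_one` (endpoint principle + the piece theorem, files `…CrossPlusOneEndpoint/Piece/Reduced`). -/
theorem conjectureN_53_cross_plus_one (A₁ A₂ A₃ A₄ A₅ B₁ B₂ B₃ u₁ u₂ u₃ u₄ u₅ v₁ v₂ v₃ As us : ℝ) (x₁ x₂ x₃ x₄ x₅ y₁ y₂ y₃ y₄ y₅ p₁ p₂ p₃ q₁ q₂ q₃ : ℝ)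
    (hA : A₁ + A₂ + A₃ + A₄ + A₅ = B₁ + B₂ + B₃) (hC : u₁ + u₂ + u₃ + u₄ + u₅ = v₁ + v₂ + v₃)
    (hP2 : ((A₁ * u₁ ^ 2 + A₂ * u₂ ^ 2 + A₃ * u₃ ^ 2 + A₄ * u₄ ^ 2 + A₅ * u₅ ^ 2) - (B₁ * v₁ ^ 2 + B₂ * v₂ ^ 2 + B₃ * v₃ ^ 2)) = 0)
    (hP4 : ((u₁ ^ 3 + u₂ ^ 3 + u₃ ^ 3 + u₄ ^ 3 + u₅ ^ 3) - (v₁ ^ 3 + v₂ ^ 3 + v₃ ^ 3)) = 0)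
    (hP1 : ((A₁ ^ 2 * u₁ + A₂ ^ 2 * u₂ + A₃ ^ 2 * u₃ + A₄ ^ 2 * u₄ + A₅ ^ 2 * u₅) - (B₁ ^ 2 * v₁ + B₂ ^ 2 * v₂ + B₃ ^ 2 * v₃)) = 0)
    (hA₁ : A₁ = As + x₁ + y₁) (hA₂ : A₂ = As + x₂ + y₂) (hA₃ : A₃ = As + x₃ + y₃) (hA₄ : A₄ = As + x₄ + y₄) (hA₅ : A₅ = As + x₅ + y₅) (hu₁ : u₁ = us + x₁ - y₁) (hu₂ : u₂ = us + x₂ - y₂) (hu₃ : u₃ = us + x₃ - y₃) (hu₄ : u₄ = us + x₄ - y₄) (hu₅ : u₅ = us + x₅ - y₅) (hB₁ : B₁ = As - p₁ - q₁) (hB₂ : B₂ = As - p₂ - q₂) (hB₃ : B₃ = As - p₃ - q₃) (hv₁ : v₁ = us + q₁ - p₁) (hv₂ : v₂ = us + q₂ - p₂) (hv₃ : v₃ = us + q₃ - p₃)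
    (hx₁ : 0 ≤ x₁) (hx₂ : 0 ≤ x₂) (hx₃ : 0 ≤ x₃) (hx₄ : 0 ≤ x₄) (hx₅ : 0 ≤ x₅) (hy₁ : 0 ≤ y₁) (hy₂ : 0 ≤ y₂) (hy₃ : 0 ≤ y₃) (hy₄ : 0 ≤ y₄) (hy₅ : 0 ≤ y₅) (hp₁ : 0 ≤ p₁) (hp₂ : 0 ≤ p₂) (hp₃ : 0 ≤ p₃) (hq₁ : 0 ≤ q₁) (hq₂ : 0 ≤ q₂) (hq₃ : 0 ≤ q₃)
    (hxy₂ : x₂ * y₂ = 0) (hxy₃ : x₃ * y₃ = 0) (hxy₄ : x₄ * y₄ = 0) (hxy₅ : x₅ * y₅ = 0) (hpq₁ : p₁ * q₁ = 0) (hpq₂ : p₂ * q₂ = 0) (hpq₃ : p₃ * q₃ = 0) :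
    0 ≤ (1 / 2) * ((A₁ ^ 2 + A₂ ^ 2 + A₃ ^ 2 + A₄ ^ 2 + A₅ ^ 2) - (B₁ ^ 2 + B₂ ^ 2 + B₃ ^ 2)) * ((u₁ ^ 2 + u₂ ^ 2 + u₃ ^ 2 + u₄ ^ 2 + u₅ ^ 2) - (v₁ ^ 2 + v₂ ^ 2 + v₃ ^ 2))
        + ((A₁ * u₁ + A₂ * u₂ + A₃ * u₃ + A₄ * u₄ + A₅ * u₅) - (B₁ * v₁ + B₂ * v₂ + B₃ * v₃)) ^ 2
        - 3 * ((A₁ ^ 2 * u₁ ^ 2 + A₂ ^ 2 * u₂ ^ 2 + A₃ ^ 2 * u₃ ^ 2 + A₄ ^ 2 * u₄ ^ 2 + A₅ ^ 2 * u₅ ^ 2) - (B₁ ^ 2 * v₁ ^ 2 + B₂ ^ 2 * v₂ ^ 2 + B₃ ^ 2 * v₃ ^ 2))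
      + (3 * ((u₁ ^ 4 + u₂ ^ 4 + u₃ ^ 4 + u₄ ^ 4 + u₅ ^ 4) - (v₁ ^ 4 + v₂ ^ 4 + v₃ ^ 4)) - (3 / 2) * ((u₁ ^ 2 + u₂ ^ 2 + u₃ ^ 2 + u₄ ^ 2 + u₅ ^ 2) - (v₁ ^ 2 + v₂ ^ 2 + v₃ ^ 2)) ^ 2) := by
  have hG := Summit.HodgeConjecture.HodgeConjecture.WeilClassTestFormatFiveThreeCrossPlusOneGauge.G_gauge_cross_plus_one A₁ A₂ A₃ A₄ A₅ B₁ B₂ B₃ u₁ u₂ u₃ u₄ u₅ v₁ v₂ v₃ As us (x₁ * y₁) hA hC hP2 hP4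
    (by rw [hA₁, hu₁]; ring) (by rw [hA₂, hu₂]; linear_combination 4 * hxy₂) (by rw [hA₃, hu₃]; linear_combination 4 * hxy₃) (by rw [hA₄, hu₄]; linear_combination 4 * hxy₄) (by rw [hA₅, hu₅]; linear_combination 4 * hxy₅) (by rw [hB₁, hv₁]; linear_combination 4 * hpq₁) (by rw [hB₂, hv₂]; linear_combination 4 * hpq₂) (by rw [hB₃, hv₃]; linear_combination 4 * hpq₃)
  rw [hG]
  have hus : 2 * us = (y₁ + y₂ + y₃ + y₄ + y₅ + q₁ + q₂ + q₃) - (x₁ + x₂ + x₃ + x₄ + x₅ + p₁ + p₂ + p₃) := by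
    have h := hC
    rw [hu₁, hu₂, hu₃, hu₄, hu₅, hv₁, hv₂, hv₃] at h
    linarith
  have hAs : 2 * As = -((x₁ + x₂ + x₃ + x₄ + x₅ + p₁ + p₂ + p₃) + (y₁ + y₂ + y₃ + y₄ + y₅ + q₁ + q₂ + q₃)) := by
    have h := hA
    rw [hA₁, hA₂, hA₃, hA₄, hA₅, hB₁, hB₂, hB₃] at h
    linarith
  subst hA₁ hA₂ hA₃ hA₄ hA₅ hu₁ hu₂ hu₃ hu₄ hu₅ hB₁ hB₂ hB₃ hv₁ hv₂ hv₃
  rw [Mo_corner, T_corner, Summit.HodgeConjecture.HodgeConjecture.WeilClassTestFormatFiveThreeCrossPlusOneAggregates.S_on_cross_plus_one x₁ x₂ x₃ x₄ x₅ y₁ y₂ y₃ y₄ y₅ p₁ p₂ p₃ q₁ q₂ q₃ us As hus hAs hxy₂ hxy₃ hxy₄ hxy₅ hpq₁ hpq₂ hpq₃]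
  have hP2a := (Summit.HodgeConjecture.HodgeConjecture.WeilClassTestFormatFiveThreeCrossPlusOneAggregates.P2_on_cross_plus_one x₁ x₂ x₃ x₄ x₅ y₁ y₂ y₃ y₄ y₅ p₁ p₂ p₃ q₁ q₂ q₃ us As hus hAs hxy₂ hxy₃ hxy₄ hxy₅ hpq₁ hpq₂ hpq₃).symm.trans hP2
  have hP4a := (Summit.HodgeConjecture.HodgeConjecture.WeilClassTestFormatFiveThreeCrossPlusOneAggregates.P4_on_cross_plus_one x₁ x₂ x₃ x₄ x₅ y₁ y₂ y₃ y₄ y₅ p₁ p₂ p₃ q₁ q₂ q₃ us As hus hAs hxy₂ hxy₃ hxy₄ hxy₅ hpq₁ hpq₂ hpq₃).symm.trans hP4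
  have hKa : -2*((y₁ ^ 2 + y₂ ^ 2 + y₃ ^ 2 + y₄ ^ 2 + y₅ ^ 2) - (q₁ ^ 2 + q₂ ^ 2 + q₃ ^ 2))*(x₁ + x₂ + x₃ + x₄ + x₅ + p₁ + p₂ + p₃) + 2*((x₁ ^ 2 + x₂ ^ 2 + x₃ ^ 2 + x₄ ^ 2 + x₅ ^ 2) - (p₁ ^ 2 + p₂ ^ 2 + p₃ ^ 2))*(y₁ + y₂ + y₃ + y₄ + y₅ + q₁ + q₂ + q₃) + 2*(y₁ + y₂ + y₃ + y₄ + y₅ + q₁ + q₂ + q₃)^2*(x₁ + x₂ + x₃ + x₄ + x₅ + p₁ + p₂ + p₃) - 2*(y₁ + y₂ + y₃ + y₄ + y₅ + q₁ + q₂ + q₃)*(x₁ + x₂ + x₃ + x₄ + x₅ + p₁ + p₂ + p₃)^2 - 4*(y₁ + y₂ + y₃ + y₄ + y₅ + q₁ + q₂ + q₃)*x₁*y₁ + 4*(x₁ + x₂ + x₃ + x₄ + x₅ + p₁ + p₂ + p₃)*x₁*y₁ - 4*x₁^2*y₁ + 4*x₁*y₁^2 = 0 := by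
    rw [← Summit.HodgeConjecture.HodgeConjecture.WeilClassTestFormatFiveThreeCrossPlusOneAggregates.K_on_cross_plus_one x₁ x₂ x₃ x₄ x₅ y₁ y₂ y₃ y₄ y₅ p₁ p₂ p₃ q₁ q₂ q₃ us As hus hAs hxy₂ hxy₃ hxy₄ hxy₅ hpq₁ hpq₂ hpq₃, hP4, hP1]; norm_num
  have hX1 : 0 ≤ (x₁ + x₂ + x₃ + x₄ + x₅ + p₁ + p₂ + p₃) - x₁ := by linarith
  have hM1 : 0 ≤ (y₁ + y₂ + y₃ + y₄ + y₅ + q₁ + q₂ + q₃) - y₁ := by linarith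
  exact aggregate_cross_plus_one (x₁ + x₂ + x₃ + x₄ + x₅ + p₁ + p₂ + p₃) (y₁ + y₂ + y₃ + y₄ + y₅ + q₁ + q₂ + q₃) ((x₁ ^ 2 + x₂ ^ 2 + x₃ ^ 2 + x₄ ^ 2 + x₅ ^ 2) - (p₁ ^ 2 + p₂ ^ 2 + p₃ ^ 2)) ((y₁ ^ 2 + y₂ ^ 2 + y₃ ^ 2 + y₄ ^ 2 + y₅ ^ 2) - (q₁ ^ 2 + q₂ ^ 2 + q₃ ^ 2)) ((x₁ ^ 3 + x₂ ^ 3 + x₃ ^ 3 + x₄ ^ 3 + x₅ ^ 3) + (p₁ ^ 3 + p₂ ^ 3 + p₃ ^ 3)) ((y₁ ^ 3 + y₂ ^ 3 + y₃ ^ 3 + y₄ ^ 3 + y₅ ^ 3) + (q₁ ^ 3 + q₂ ^ 3 + q₃ ^ 3)) x₁ y₁ us hus hx₁ hy₁ hX1 hM1 hP2a hP4a hKa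
    (cauchy_schwarz_H x₁ x₂ x₃ x₄ x₅ p₁ p₂ p₃ hx₂ hx₃ hx₄ hx₅ hp₁ hp₂ hp₃) (cauchy_schwarz_V y₁ y₂ y₃ y₄ y₅ q₁ q₂ q₃ hy₂ hy₃ hy₄ hy₅ hq₁ hq₂ hq₃)

end Summit.HodgeConjecture.HodgeConjecture.WeilClassTestFormatFiveThreeCrossPlusOne
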